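import Mathlib
import HarnessLib
import Summits.NavierStokesRegularity.NavierStokesRegularity.Theorems.PoloidalWindowDoorLrcModEntireTwistingTHLocalSlope
import Summits.NavierStokesRegularity.NavierStokesRegularity.Theorems.PoloidalWindowDoorLrcModEntireTwistingTHLocalCalculus
import Summits.NavierStokesRegularity.NavierStokesRegularity.Theorems.PoloidalWindowDoorPoloidalWindowRigidityTimeHeightShearWeight
import Summits.NavierStokesRegularity.NavierStokesRegularity.Theorems.PoloidalWindowDoorPoloidalWindowRigidityStructureFunctionNormalForm
import Summits.NavierStokesRegularity.NavierStokesRegularity.Theorems.PoloidalWindowDoorPoloidalWindowRigiditySlopeFunctionSource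
import Summits.NavierStokesRegularity.NavierStokesRegularity.Theorems.PoloidalWindowDoorPoloidalWindowRigidityUntwistedDynamicsAnalytic

/-!
# Route `PoloidalWindowDoor`, item `LrcModEntire` (stmt-NavierStokesRegularity-20428), stub `stub_twistingTH` —
# THE LOCAL (TH)∩TWISTING DATUM OF A CLASS PROFILE ON A TWISTING (TH) WINDOW

Cell ns-regularity-ideate, seat ns-poloidal-K2-p3 gen 7 (lead of item 20428; file landed `--supports stmt-NavierStokesRegularity-20428`).

`…LrcModEntireTwistingTHLocal.stub_twistingTH_of_localEmpty` (p569136) CONSUMES the local emptiness statement `hempty` internally.  This file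
EXPOSES the datum its proof constructs, so that every variant of the local statement (extra point conditions available from the window —
the hyperbolic sign `μ(p₀) < 0` asked for by the interim K2 lead ns-poloidal-K2-p2 g6 (KERNEL-THMA-g6 §5), further pins, further laws)
is derived in a few lines instead of re-running the construction:

`exists_localTHDatum` — for a profile `v` of the route's Type-I class (Type-I rate, continuous, Oseen-mild, divergence-free), poloidal
along `e₃`, and a nonempty open window `W` in the backward slab which is non-degenerate, carries the item's pin (slope a function of `t`
alone on no open subset), has non-zero twist bracket and slope `m(t, x₂)` (stratum (TH)): there are a real-analytic slope `μ(t,z)`, a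
real-analytic pressure datum `A(t,z)`, an open `U ⊆ W` and `p₀ ∈ U` such that `u := v` satisfies on `U` the four local laws of (TH) —
poloidal `∂₀u₁ = ∂₁u₀`, `div u = 0`, `∂₂u_b = μ(t,y₂) ∂_b u₂` (`b = 0,1`), and the vertical momentum equation with the (TH) pressure law
`(1−μ)(∂ₜu₂ + u·∇u₂ − Δu₂) = A + (μ_t − μ_zz) u₂ + (μ_z/2) u₂² − 2μ_z ∂₂u₂` — and at `p₀`: twist `≠ 0`, `μ ≠ 0`, `μ ≠ 1`, `∂_zμ ≠ 0`.
The proof is that of p569136 verbatim (local analytic slope + pin ⇒ `∂_zμ ≠ 0` point + `C³` bump modification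
`…TwistingTHLocalSlope`; K2-p2's `…TimeHeightShearWeight.horizFDeriv_weightSource_eq_zero` ⇒ height-only source ⇒ `A`;
`…SlopeFunctionPressure.material_vert_eq_residual`), ending in the tuple instead of the call to `hempty`.

WHAT THIS IS NOT: not a claim about Navier–Stokes regularity and not the stub — the extraction of the local datum
(bears_on LADDER-NS N0, rung N0-LocalTubeDoorPoloidal, item 20428 / crux K2 = stmt-19708).
-/

noncomputable section

-- the summit and its single sub-problem share the name (CONVENTIONS §1), as in every Theorems file
set_option linter.dupNamespace false


namespace Summit.NavierStokesRegularity.NavierStokesRegularity.Theorems.PoloidalWindowDoorLrcModEntireTwistingTHLocalDatum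

open Set Function Filter Topology Metric InnerProductSpace
open scoped RealInnerProductSpace InnerProductSpace Laplacian ContDiff
open Literature.Analysis Literature.Analysis.FluidPDE
open Summit.NavierStokesRegularity.NavierStokesRegularity.Theorems.LocalSineTubeDoorProfileAlignedWindowRigidityAncient
open Summit.NavierStokesRegularity.NavierStokesRegularity.Theorems.TubeAlternative.AnalyticPropagation
open Summit.NavierStokesRegularity.NavierStokesRegularity.Theorems.PoloidalWindowDoorPoloidalWindowRigidityWindow
open Summit.NavierStokesRegularity.NavierStokesRegularity.Theorems.PoloidalWindowDoorPoloidalWindowRigidityVelocityGradientLaw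
open Summit.NavierStokesRegularity.NavierStokesRegularity.Theorems.PoloidalWindowDoorPoloidalWindowRigidityMaterialLeibniz
open Summit.NavierStokesRegularity.NavierStokesRegularity.Theorems.PoloidalWindowDoorPoloidalWindowRigidityConstantShearSlice
open Summit.NavierStokesRegularity.NavierStokesRegularity.Theorems.PoloidalWindowDoorPoloidalWindowRigiditySlopeFunctionPressure
open Summit.NavierStokesRegularity.NavierStokesRegularity.Theorems.PoloidalWindowDoorPoloidalWindowRigidityK2OfLrcSlope
open Summit.NavierStokesRegularity.NavierStokesRegularity.Theorems.PoloidalWindowDoorPoloidalWindowRigidityTimeHeightShearPressure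
open Summit.NavierStokesRegularity.NavierStokesRegularity.Theorems.PoloidalWindowDoorPoloidalWindowRigidityTimeHeightShearWeight
open Summit.NavierStokesRegularity.NavierStokesRegularity.Theorems.PoloidalWindowDoorPoloidalWindowRigidityStructureFunctionNormalForm
open Summit.NavierStokesRegularity.NavierStokesRegularity.Theorems.PoloidalWindowDoorPoloidalWindowRigiditySlopeFunctionSource
open Summit.NavierStokesRegularity.NavierStokesRegularity.Theorems.PoloidalWindowDoorPoloidalWindowRigidityUntwistedDynamicsAnalytic
open Summit.NavierStokesRegularity.NavierStokesRegularity.Theorems.PoloidalWindowDoorLrcModEntireTwistingTHLocalSlope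
open Summit.NavierStokesRegularity.NavierStokesRegularity.Theorems.PoloidalWindowDoorLrcModEntireTwistingTHLocalCalculus

/-! ### The datum -/

variable {C : ℝ} {v : ℝ → EuclideanSpace ℝ (Fin 3) → EuclideanSpace ℝ (Fin 3)}

/-- **THE LOCAL (TH)∩TWISTING DATUM.**  A profile of the route's Type-I class, poloidal along `e₃`, on a nonempty open non-degenerate
window `W` of the backward slab with the item's pin, non-zero twist bracket and slope `m(t, x₂)` on `W`, carries — on some open `U ⊆ W`
around some `p₀` — a real-analytic slope `μ(t,z)` and pressure datum `A(t,z)` with the four local laws of (TH) for `u := v` on `U`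
and the point conditions twist `≠ 0`, `μ ∉ {0,1}`, `∂_zμ ≠ 0` at `p₀` (the data consumed by every local emptiness statement). -/
theorem exists_localTHDatum (hrate : Literature.Analysis.FluidPDE.HasTypeITimeDecay C v)
    (hcont : ContinuousOn (Function.uncurry v) (Set.Iio (0 : ℝ) ×ˢ Set.univ))
    (hmild : ∀ s t : ℝ, s < t → t < 0 → ∀ x, v t x =
      Literature.Analysis.UnboundedOperators.heatExtension (v s) (t - s) x -
        Literature.Analysis.FluidPDE.oseenDuhamel 1 s v v t x)
    (hdiv : ∀ t < 0, Literature.Analysis.FluidPDE.VectorCalculus.IsDivFree (v t))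
    (hpol : ∀ s < 0, ∀ y, ⟪Literature.Analysis.FluidPDE.curl (v s) y, EuclideanSpace.single 2 1⟫_ℝ = 0)
    {W : Set (ℝ × EuclideanSpace ℝ (Fin 3))} (hW : IsOpen W) (hWne : W.Nonempty) (hWs : W ⊆ Set.Iio (0 : ℝ) ×ˢ Set.univ)
    (hnd : ∀ z ∈ W, Literature.Analysis.FluidPDE.curl (v z.1) z.2 ≠ 0 ∧
      (fderiv ℝ (v z.1) z.2 (EuclideanSpace.single 0 1) 2 ≠ 0 ∨ fderiv ℝ (v z.1) z.2 (EuclideanSpace.single 1 1) 2 ≠ 0) ∧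
      (fderiv ℝ (v z.1) z.2 (EuclideanSpace.single 2 1) 0 ≠ 0 ∨ fderiv ℝ (v z.1) z.2 (EuclideanSpace.single 2 1) 1 ≠ 0))
    (hpin : ∀ m : ℝ → ℝ, ∀ W₁ : Set (ℝ × EuclideanSpace ℝ (Fin 3)), W₁ ⊆ W → IsOpen W₁ → W₁.Nonempty →
      ∃ z ∈ W₁, ∃ b : Fin 3, b ≠ 2 ∧
        fderiv ℝ (v z.1) z.2 (EuclideanSpace.single 2 1) b ≠
          m z.1 * fderiv ℝ (v z.1) z.2 (EuclideanSpace.single b 1) 2)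
    (htw : ∀ z ∈ W,
      fderiv ℝ (fun x => fderiv ℝ (v z.1) x (EuclideanSpace.single 2 1) 2) z.2 (EuclideanSpace.single 0 1) *
          fderiv ℝ (v z.1) z.2 (EuclideanSpace.single 1 1) 2 -
        fderiv ℝ (fun x => fderiv ℝ (v z.1) x (EuclideanSpace.single 2 1) 2) z.2 (EuclideanSpace.single 1 1) *
          fderiv ℝ (v z.1) z.2 (EuclideanSpace.single 0 1) 2 ≠ 0)
    {m : ℝ → ℝ → ℝ} (hm : ∀ z ∈ W, ∀ b : Fin 3, b ≠ 2 →
      fderiv ℝ (v z.1) z.2 (EuclideanSpace.single 2 1) b =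
        m z.1 (z.2 2) * fderiv ℝ (v z.1) z.2 (EuclideanSpace.single b 1) 2) :
    ∃ (μ A : ℝ → ℝ → ℝ) (U : Set (ℝ × EuclideanSpace ℝ (Fin 3))) (p₀ : ℝ × EuclideanSpace ℝ (Fin 3)),
      IsOpen U ∧ p₀ ∈ U ∧ U ⊆ W ∧
      AnalyticOnNhd ℝ (Function.uncurry v) U ∧
      (∀ p ∈ U, AnalyticAt ℝ (Function.uncurry μ) (p.1, p.2 2)) ∧
      (∀ p ∈ U, AnalyticAt ℝ (Function.uncurry A) (p.1, p.2 2)) ∧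
      (∀ p ∈ U, fderiv ℝ (v p.1) p.2 (EuclideanSpace.single 0 1) 1 = fderiv ℝ (v p.1) p.2 (EuclideanSpace.single 1 1) 0) ∧
      (∀ p ∈ U, fderiv ℝ (v p.1) p.2 (EuclideanSpace.single 0 1) 0 + fderiv ℝ (v p.1) p.2 (EuclideanSpace.single 1 1) 1 +
        fderiv ℝ (v p.1) p.2 (EuclideanSpace.single 2 1) 2 = 0) ∧
      (∀ p ∈ U, ∀ b : Fin 3, b ≠ 2 →
        fderiv ℝ (v p.1) p.2 (EuclideanSpace.single 2 1) b =
          μ p.1 (p.2 2) * fderiv ℝ (v p.1) p.2 (EuclideanSpace.single b 1) 2) ∧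
      (∀ p ∈ U,
        (1 - μ p.1 (p.2 2)) *
            (deriv (fun s => v s p.2 2) p.1 + fderiv ℝ (fun y => v p.1 y 2) p.2 (v p.1 p.2)
              - Δ (fun y => v p.1 y 2) p.2) =
          A p.1 (p.2 2) + (deriv (fun s => μ s (p.2 2)) p.1 - deriv (deriv (μ p.1)) (p.2 2)) * v p.1 p.2 2
            + deriv (μ p.1) (p.2 2) / 2 * v p.1 p.2 2 ^ 2
            - 2 * deriv (μ p.1) (p.2 2) * fderiv ℝ (v p.1) p.2 (EuclideanSpace.single 2 1) 2) ∧
      fderiv ℝ (fun y => fderiv ℝ (v p₀.1) y (EuclideanSpace.single 2 1) 2) p₀.2 (EuclideanSpace.single 0 1) *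
            fderiv ℝ (v p₀.1) p₀.2 (EuclideanSpace.single 1 1) 2 -
          fderiv ℝ (fun y => fderiv ℝ (v p₀.1) y (EuclideanSpace.single 2 1) 2) p₀.2 (EuclideanSpace.single 1 1) *
            fderiv ℝ (v p₀.1) p₀.2 (EuclideanSpace.single 0 1) 2 ≠ 0 ∧
      μ p₀.1 (p₀.2 2) ≠ 0 ∧ μ p₀.1 (p₀.2 2) ≠ 1 ∧ deriv (μ p₀.1) (p₀.2 2) ≠ 0 := by
  obtain ⟨z₁, hz₁⟩ := hWne
  have hanV : AnalyticOnNhd ℝ (uncurry v) (Iio (0 : ℝ) ×ˢ univ) :=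
    analyticOnNhd_uncurry hcont (bdd_of_hasTypeITimeDecay hrate) hmild
  -- ## Step 1: local analytic slope on a product ball `ball z₁ r ⊆ W`
  obtain ⟨r, hr, hballW, μ, hμid, hμan⟩ :=
    exists_local_analytic_slope hrate hcont hmild hW hWs hz₁ (hnd z₁ hz₁).2.1 hm
  -- ## Step 2: the pin gives a base point with `∂_z μ ≠ 0`
  have hμd : ∀ q ∈ ball ((z₁.1, z₁.2 2) : ℝ × ℝ) r, DifferentiableAt ℝ (μ q.1) q.2 := by
    rintro ⟨s, c⟩ hq
    have h := (hμan _ hq).differentiableAt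
    have h2 : DifferentiableAt ℝ (uncurry μ ∘ fun c' : ℝ => (s, c')) c :=
      h.comp c ((differentiableAt_const _).prodMk differentiableAt_id)
    simpa [Function.comp_def] using h2
  obtain ⟨p₀, hp₀, hμz⟩ := exists_height_deriv_ne_zero hr hμd hμid
    (fun n W₁ hW₁ hW₁o hW₁ne => hpin n W₁ (hW₁.trans hballW) hW₁o hW₁ne)
  -- ## Step 3: a ball around `p₀` inside `ball z₁ r`; `μ` is analytic on its shadow
  obtain ⟨ρ₀, hρ₀, hρ₀sub⟩ := Metric.isOpen_iff.1 isOpen_ball p₀ hp₀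
  set q₀ : ℝ × ℝ := (p₀.1, p₀.2 2) with hq₀
  have hO : ∀ q ∈ ball q₀ ρ₀, AnalyticAt ℝ (uncurry μ) q := by
    rintro ⟨s, c⟩ hq
    apply hμan
    have hmem : ((s, p₀.2 + (c - p₀.2 2) • EuclideanSpace.single 2 (1 : ℝ)) : ℝ × EuclideanSpace ℝ (Fin 3)) ∈
        ball p₀ ρ₀ := by
      have e : dist ((s, p₀.2 + (c - p₀.2 2) • EuclideanSpace.single 2 (1 : ℝ)) : ℝ × EuclideanSpace ℝ (Fin 3)) p₀ =
          dist ((s, c) : ℝ × ℝ) (p₀.1, p₀.2 2) := dist_vmove_prod p₀ (s, c)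
      rw [mem_ball, e]; exact mem_ball.1 hq
    have h := shadow_mem_ball (hρ₀sub hmem)
    simpa only [vmove_apply_two] using h
  -- ## Step 4: a `C³` modification `G` of `uncurry μ`, equal to it on `ball q₀ ρ₁`
  obtain ⟨G, ρ₁, hρ₁, hG3, hρ₁sub, hGeq⟩ := exists_contDiff_eq_near isOpen_ball (mem_ball_self hρ₀) hO 3
  set μ' : ℝ → ℝ → ℝ := fun s c => G (s, c) with hμ'
  have hμ'unc : uncurry μ' = G := by funext q; rcases q with ⟨s, c⟩; rfl
  have hμ'3 : ContDiff ℝ 3 (uncurry μ') := by rw [hμ'unc]; exact hG3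
  -- ## Step 5: the final neighbourhood `U := ball p₀ ρ`
  set ρ : ℝ := min ρ₀ ρ₁ with hρdef
  have hρ : 0 < ρ := lt_min hρ₀ hρ₁
  set U : Set (ℝ × EuclideanSpace ℝ (Fin 3)) := ball p₀ ρ with hU
  have hUo : IsOpen U := isOpen_ball; have hp₀U : p₀ ∈ U := mem_ball_self hρ
  have hUsub : U ⊆ ball z₁ r := fun p hp => hρ₀sub (ball_subset_ball (min_le_left _ _) hp); have hUW := hUsub.trans hballW
  have hUt : ∀ p ∈ U, p.1 < 0 := fun p hp => (mem_prod.1 (hWs (hUW hp))).1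
  have hUslab : U ⊆ Iio (0 : ℝ) ×ˢ univ := fun p hp => hWs (hUW hp)
  have hshadow : ∀ p ∈ U, ((p.1, p.2 2) : ℝ × ℝ) ∈ ball q₀ ρ₁ := fun p hp =>
    ball_subset_ball (min_le_right _ _) (shadow_mem_ball hp)
  have hμ'eqv : ∀ p ∈ U, uncurry μ' =ᶠ[𝓝 ((p.1, p.2 2) : ℝ × ℝ)] uncurry μ := by
    intro p hp
    filter_upwards [isOpen_ball.mem_nhds (hshadow p hp)] with q hq
    rw [hμ'unc]; exact hGeq q hq
  have hμ'val : ∀ p ∈ U, μ' p.1 (p.2 2) = μ p.1 (p.2 2) := fun p hp => (hμ'eqv p hp).self_of_nhds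
  have hμ'an : ∀ p ∈ U, AnalyticAt ℝ (uncurry μ') (p.1, p.2 2) := fun p hp =>
    (hO _ (hρ₁sub (hshadow p hp))).congr (hμ'eqv p hp).symm
  have hGan : ∀ p ∈ U, AnalyticAt ℝ G (p.1, p.2 2) := fun p hp => by rw [← hμ'unc]; exact hμ'an p hp
  have hshear : ∀ p ∈ U, ∀ b : Fin 3, b ≠ 2 →
      fderiv ℝ (v p.1) p.2 (EuclideanSpace.single 2 1) b =
        μ' p.1 (p.2 2) * fderiv ℝ (v p.1) p.2 (EuclideanSpace.single b 1) 2 := by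
    intro p hp b hb
    rw [hμ'val p hp]; exact hμid p (hUsub hp) b hb
  have hslope : ∀ p ∈ U, ∀ᶠ z in 𝓝 p, ∀ b : Fin 3, b ≠ 2 →
      fderiv ℝ (v z.1) z.2 (EuclideanSpace.single 2 1) b =
        μ' z.1 (z.2 2) * fderiv ℝ (v z.1) z.2 (EuclideanSpace.single b 1) 2 := by
    intro p hp
    filter_upwards [hUo.mem_nhds hp] with z hz using hshear z hz
  -- ## Step 6: the doubled source `F = 2𝒜` has vanishing horizontal derivatives on `U`
  set F : ℝ → EuclideanSpace ℝ (Fin 3) → ℝ := fun t y =>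
    2 * (1 - μ' t (y 2)) * (timeDerivWithin (Iio 0) v t y + convect (v t) (v t) y - Δ (v t) y) 2
      - 2 * (deriv (fun s => μ' s (y 2)) t - deriv (deriv (μ' t)) (y 2)) * v t y 2
      - deriv (μ' t) (y 2) * v t y 2 ^ 2
      + 4 * deriv (μ' t) (y 2) * fderiv ℝ (v t) y (EuclideanSpace.single 2 1) 2 with hF
  have hFh : ∀ p ∈ U, ∀ b : Fin 3, b ≠ 2 → fderiv ℝ (F p.1) p.2 (EuclideanSpace.single b 1) = 0 := by
    intro p hp b hb
    exact horizFDeriv_weightSource_eq_zero hrate hcont hmild hdiv hpol hμ'3 (hUt p hp) p.2 (hslope p hp) hb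
  have hsl : ∀ t c : ℝ, deriv (fun s => μ' s c) t = fderiv ℝ G (t, c) (1, 0) ∧
      deriv (μ' t) c = fderiv ℝ G (t, c) (0, 1) ∧
      deriv (deriv (μ' t)) c = fderiv ℝ (fun q => fderiv ℝ G q (0, 1)) (t, c) (0, 1) :=
    fun t c => slice_derivs_of_contDiff hG3 t c
  -- ## Step 7: differentiability of `F t` on the slices of `U`
  have hFd : ∀ p ∈ U, DifferentiableAt ℝ (F p.1) p.2 := by
    rintro ⟨t, x⟩ hp
    have ht : t < 0 := hUt _ hp
    have hA : IsTypeIAncientMild C v := isTypeIAncientMild_of_class hrate hcont hmild hdiv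
    have hs : ContDiff ℝ ∞ (v t) := hA.contDiff_slice ht
    have hGt3 : ContDiff ℝ 3 (μ' t) := hG3.comp (contDiff_const.prodMk contDiff_id)
    have hGtd : Differentiable ℝ (μ' t) := hGt3.differentiable (by norm_num)
    have hμ'2 : ContDiff ℝ 2 (deriv (μ' t)) :=
      (contDiff_succ_iff_deriv.1 (hGt3 : ContDiff ℝ ((2 : ℕ∞) + 1 : ℕ∞) (μ' t))).2.2
    have hμ''1 : ContDiff ℝ 1 (deriv (deriv (μ' t))) :=
      (contDiff_succ_iff_deriv.1 (hμ'2 : ContDiff ℝ ((1 : ℕ∞) + 1 : ℕ∞) (deriv (μ' t)))).2.2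
    have hMt : ContDiff ℝ 2 (fun c => deriv (fun s => μ' s c) t) := by
      have e : (fun c => deriv (fun s => μ' s c) t) = fun c => fderiv ℝ G (t, c) (1, 0) :=
        funext fun c => (hsl t c).1
      rw [e]
      exact ((hG3.fderiv_right (m := 2) (by norm_cast)).clm_apply contDiff_const).comp
        (contDiff_const.prodMk contDiff_id)
    have hR : DifferentiableAt ℝ
        (fun y => timeDerivWithin (Iio 0) v t y + convect (v t) (v t) y - Δ (v t) y) x := by
      have h1 : ContDiff ℝ ∞ (timeDerivWithin (Iio 0) v t) := by
        rw [timeDerivWithin_Iio_eq_deriv ht]; exact contDiff_timeDeriv_slice hrate hcont hmild hdiv ht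
      have h2 : ContDiff ℝ ∞ (fun y => convect (v t) (v t) y) :=
        (hs.fderiv_right (m := ∞) (by norm_cast)).clm_apply hs
      have h3 : ContDiff ℝ 1 (Δ (v t)) := contDiff_laplacian (n := 1) (hs.of_le (by norm_cast))
      exact (((h1.differentiable (by simp)) x).add ((h2.differentiable (by simp)) x)).sub
        ((h3.differentiable (by simp)) x)
    have hR2 : DifferentiableAt ℝ
        (fun y => (timeDerivWithin (Iio 0) v t y + convect (v t) (v t) y - Δ (v t) y) 2) x :=
      ((EuclideanSpace.proj (𝕜 := ℝ) (2 : Fin 3) : EuclideanSpace ℝ (Fin 3) →L[ℝ] ℝ).differentiableAt).comp x hR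
    have hE : DifferentiableAt ℝ (fun y => fderiv ℝ (v t) y (EuclideanSpace.single 2 1) 2) x :=
      ((contDiff_fderiv_coord hrate hcont hmild hdiv ht (EuclideanSpace.single 2 1) 2).differentiable (by simp)) x
    have hθ : DifferentiableAt ℝ (fun y => v t y 2) x :=
      ((contDiff_vert_slice hrate hcont hmild hdiv ht).differentiable (by simp)) x
    have hw1 : DifferentiableAt ℝ (fun y : EuclideanSpace ℝ (Fin 3) => μ' t (y 2)) x :=
      (contDiff_comp_height (hGt3.of_le (by norm_cast))).differentiable (by norm_num) x
    have hw2 : DifferentiableAt ℝ (fun y : EuclideanSpace ℝ (Fin 3) => deriv (fun s => μ' s (y 2)) t) x :=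
      (contDiff_comp_height hMt).differentiable (by norm_num) x
    have hw3 : DifferentiableAt ℝ (fun y : EuclideanSpace ℝ (Fin 3) => deriv (deriv (μ' t)) (y 2)) x :=
      (contDiff_comp_height hμ''1).differentiable (by norm_num) x
    have hw4 : DifferentiableAt ℝ (fun y : EuclideanSpace ℝ (Fin 3) => deriv (μ' t) (y 2)) x :=
      (contDiff_comp_height hμ'2).differentiable (by norm_num) x
    simp only [hF]
    exact (((((hw1.const_sub 1).const_mul 2).mul hR2).sub (((hw2.sub hw3).const_mul 2).mul hθ)).sub
      (hw4.mul (hθ.pow 2))).add ((hw4.const_mul 4).mul hE)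
  -- ## Step 8: `F` is height-only on `U`: `F(t,y) = F(t, ỹ)` with `ỹ` on the vertical line through `p₀.2`
  have hFconst : ∀ p ∈ U,
      F p.1 p.2 = F p.1 (p₀.2 + (p.2 2 - p₀.2 2) • EuclideanSpace.single 2 (1 : ℝ)) := by
    rintro ⟨t, y⟩ hp
    have hpt : dist t p₀.1 < ρ := lt_of_le_of_lt (le_max_left _ _) (by rwa [hU, mem_ball, Prod.dist_eq] at hp)
    have hpy : y ∈ ball p₀.2 ρ := lt_of_le_of_lt (le_max_right _ _) (by rwa [hU, mem_ball, Prod.dist_eq] at hp)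
    have hin : ∀ y' ∈ ball p₀.2 ρ, ((t, y') : ℝ × EuclideanSpace ℝ (Fin 3)) ∈ U := by
      intro y' hy'
      rw [hU, mem_ball, Prod.dist_eq]
      exact max_lt hpt hy'
    have hmove : p₀.2 + (y 2 - p₀.2 2) • EuclideanSpace.single 2 (1 : ℝ) ∈ ball p₀.2 ρ := by
      rw [mem_ball, dist_vmove]
      have hle : |y 2 - p₀.2 2| ≤ ‖y - p₀.2‖ := by
        have := abs_apply_le_norm3 (y - p₀.2) 2; simpa using this
      exact lt_of_le_of_lt hle (by rwa [mem_ball, dist_eq_norm] at hpy)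
    exact eq_of_horizontalFDeriv_eq_zero_ball (fun y' hy' => hFd _ (hin y' hy'))
      (fun y' hy' => hFh _ (hin y' hy') 0 (by decide)) (fun y' hy' => hFh _ (hin y' hy') 1 (by decide))
      hpy hmove (by rw [vmove_apply_two])
  -- ## Step 9: the pressure datum `A`
  set A : ℝ → ℝ → ℝ := fun t c => F t (p₀.2 + (c - p₀.2 2) • EuclideanSpace.single 2 (1 : ℝ)) / 2 with hAdef
  have hAF : ∀ p ∈ U, F p.1 p.2 = 2 * A p.1 (p.2 2) := by
    intro p hp
    rw [hAdef]
    simp only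
    rw [← hFconst p hp]
    ring
  -- ## Step 10: joint analyticity of `F` on `U`, hence of `A` on the shadow
  have hFan : ∀ p ∈ U, AnalyticAt ℝ (fun z : ℝ × EuclideanSpace ℝ (Fin 3) => F z.1 z.2) p := by
    intro p hp
    have hs1 : AnalyticAt ℝ (fun z : ℝ × EuclideanSpace ℝ (Fin 3) => z.1) p := analyticAt_fst
    have hs2 : AnalyticAt ℝ (fun z : ℝ × EuclideanSpace ℝ (Fin 3) => z.2 2) p :=
      ((EuclideanSpace.proj (𝕜 := ℝ) (2 : Fin 3)).analyticAt _).comp analyticAt_snd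
    have hG0 : AnalyticAt ℝ (fun z : ℝ × EuclideanSpace ℝ (Fin 3) => μ' z.1 (z.2 2)) p :=
      (hGan p hp).comp₂ hs1 hs2
    have hGall : ∀ q ∈ ball q₀ ρ₁, AnalyticAt ℝ G q := fun q hq => by
      have h := (hO q (hρ₁sub hq)).congr (show uncurry μ =ᶠ[𝓝 q] G from by
        filter_upwards [isOpen_ball.mem_nhds hq] with q' hq' using (hGeq q' hq').symm)
      exact h
    have hH : ∀ q ∈ ball q₀ ρ₁, AnalyticAt ℝ (fun q' => fderiv ℝ G q' (0, 1)) q := fun q hq =>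
      analyticAt_dirPartial (hGall q hq) (0, 1)
    have hG1 : AnalyticAt ℝ (fun z : ℝ × EuclideanSpace ℝ (Fin 3) => deriv (fun s => μ' s (z.2 2)) z.1) p := by
      have e : (fun z : ℝ × EuclideanSpace ℝ (Fin 3) => deriv (fun s => μ' s (z.2 2)) z.1) =
          fun z => fderiv ℝ G (z.1, z.2 2) (1, 0) := funext fun z => (hsl z.1 (z.2 2)).1
      rw [e]
      exact (analyticAt_dirPartial (hGall _ (hshadow p hp)) (1, 0)).comp₂ hs1 hs2
    have hG2 : AnalyticAt ℝ (fun z : ℝ × EuclideanSpace ℝ (Fin 3) => deriv (μ' z.1) (z.2 2)) p := by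
      have e : (fun z : ℝ × EuclideanSpace ℝ (Fin 3) => deriv (μ' z.1) (z.2 2)) =
          fun z => fderiv ℝ G (z.1, z.2 2) (0, 1) := funext fun z => (hsl z.1 (z.2 2)).2.1
      rw [e]
      exact (hH _ (hshadow p hp)).comp₂ hs1 hs2
    have hG3' : AnalyticAt ℝ (fun z : ℝ × EuclideanSpace ℝ (Fin 3) => deriv (deriv (μ' z.1)) (z.2 2)) p := by
      have e : (fun z : ℝ × EuclideanSpace ℝ (Fin 3) => deriv (deriv (μ' z.1)) (z.2 2)) =
          fun z => fderiv ℝ (fun q => fderiv ℝ G q (0, 1)) (z.1, z.2 2) (0, 1) := funext fun z => (hsl z.1 (z.2 2)).2.2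
      rw [e]
      have hHan : AnalyticAt ℝ (fun q' => fderiv ℝ G q' (0, 1)) (p.1, p.2 2) := hH _ (hshadow p hp)
      exact (analyticAt_dirPartial hHan (0, 1)).comp₂ hs1 hs2
    have hpS : p ∈ Iio (0 : ℝ) ×ˢ (univ : Set (EuclideanSpace ℝ (Fin 3))) := hUslab hp
    have hRv : AnalyticAt ℝ (uncurry fun t y => timeDerivWithin (Iio 0) v t y + convect (v t) (v t) y - Δ (v t) y) p :=
      ((analyticOnNhd_uncurry_timeDerivWithin hanV isOpen_Iio p hpS).add
        (analyticOnNhd_uncurry_convect hanV hanV isOpen_Iio p hpS)).sub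
        (analyticOnNhd_uncurry_laplacian hanV isOpen_Iio p hpS)
    have hR2 : AnalyticAt ℝ (fun z : ℝ × EuclideanSpace ℝ (Fin 3) =>
        (timeDerivWithin (Iio 0) v z.1 z.2 + convect (v z.1) (v z.1) z.2 - Δ (v z.1) z.2) 2) p :=
      ((EuclideanSpace.proj (𝕜 := ℝ) (2 : Fin 3)).analyticAt _).comp hRv
    have hθ : AnalyticAt ℝ (fun z : ℝ × EuclideanSpace ℝ (Fin 3) => v z.1 z.2 2) p :=
      ((EuclideanSpace.proj (𝕜 := ℝ) (2 : Fin 3)).analyticAt _).comp (hanV p hpS)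
    have hE : AnalyticAt ℝ (fun z : ℝ × EuclideanSpace ℝ (Fin 3) =>
        fderiv ℝ (v z.1) z.2 (EuclideanSpace.single 2 1) 2) p :=
      analyticOnNhd_uncurry_fderiv_entry hrate hcont hmild 2 2 p hpS
    simp only [hF]
    exact ((((analyticAt_const.mul (analyticAt_const.sub hG0)).mul hR2).sub
      ((analyticAt_const.mul (hG1.sub hG3')).mul hθ)).sub (hG2.mul (hθ.pow 2))).add
      ((analyticAt_const.mul hG2).mul hE)
  have hAan : ∀ p ∈ U, AnalyticAt ℝ (uncurry A) (p.1, p.2 2) := by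
    intro p hp
    set ι : ℝ × ℝ → ℝ × EuclideanSpace ℝ (Fin 3) :=
      fun q => (q.1, p₀.2 + (q.2 - p₀.2 2) • EuclideanSpace.single 2 (1 : ℝ)) with hι
    have hιa : AnalyticAt ℝ ι (p.1, p.2 2) :=
      analyticAt_fst.prod (analyticAt_const.add ((analyticAt_snd.sub analyticAt_const).smul analyticAt_const))
    have hιU : ι (p.1, p.2 2) ∈ U := by
      rw [hU, mem_ball, hι, dist_vmove_prod]
      exact lt_of_lt_of_le (mem_ball.1 (shadow_mem_ball hp)) le_rfl
    have h := (hFan _ hιU).comp hιa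
    have e : uncurry A = fun q => (fun z : ℝ × EuclideanSpace ℝ (Fin 3) => F z.1 z.2) (ι q) / 2 := by
      funext q; rcases q with ⟨s, c⟩; rfl
    rw [e]
    exact h.div_const
  -- ## Step 11: the momentum equation `E` on `U`
  have hEq : ∀ p ∈ U,
      (1 - μ' p.1 (p.2 2)) *
          (deriv (fun s => v s p.2 2) p.1 + fderiv ℝ (fun y => v p.1 y 2) p.2 (v p.1 p.2) - Δ (fun y => v p.1 y 2) p.2) =
        A p.1 (p.2 2) + (deriv (fun s => μ' s (p.2 2)) p.1 - deriv (deriv (μ' p.1)) (p.2 2)) * v p.1 p.2 2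
          + deriv (μ' p.1) (p.2 2) / 2 * v p.1 p.2 2 ^ 2
          - 2 * deriv (μ' p.1) (p.2 2) * fderiv ℝ (v p.1) p.2 (EuclideanSpace.single 2 1) 2 := by
    intro p hp
    have h := hAF p hp
    rw [material_vert_eq_residual hrate hcont hmild hdiv (hUt p hp) p.2]
    simp only [hF] at h
    linear_combination h / 2
  -- ## Step 12: the point data at `p₀`
  have hp₀W : p₀ ∈ W := hUW hp₀U
  obtain ⟨hcurl, hgrad, hvert⟩ := hnd p₀ hp₀W
  have h20 := hshear p₀ hp₀U 0 (by decide)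
  have h21 := hshear p₀ hp₀U 1 (by decide)
  have hm0 : μ' p₀.1 (p₀.2 2) ≠ 0 := by
    intro h0
    rw [h0, zero_mul] at h20 h21
    exact hvert.elim (fun h => h h20) (fun h => h h21)
  have hω2 : curl (v p₀.1) p₀.2 2 = 0 := by
    simpa [EuclideanSpace.inner_single_right] using hpol p₀.1 (hUt p₀ hp₀U) p₀.2
  have hm1 : μ' p₀.1 (p₀.2 2) ≠ 1 := by
    intro h1
    rw [h1, one_mul] at h20 h21
    apply hcurl
    ext i
    fin_cases i <;> simp [curl, h20, h21]
    simpa [curl] using hω2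
  have hmz : deriv (μ' p₀.1) (p₀.2 2) ≠ 0 := by
    have hev : μ' p₀.1 =ᶠ[𝓝 (p₀.2 2)] μ p₀.1 := by
      have hc : ContinuousAt (fun c : ℝ => ((p₀.1, c) : ℝ × ℝ)) (p₀.2 2) := by fun_prop
      have hnh : ball q₀ ρ₁ ∈ 𝓝 ((p₀.1, p₀.2 2) : ℝ × ℝ) := isOpen_ball.mem_nhds (hshadow p₀ hp₀U)
      filter_upwards [hc.preimage_mem_nhds hnh] with c hc'
      exact hGeq _ hc'
    rw [hev.deriv_eq]; exact hμz
  -- ## Step 13: the remaining local laws on `U` and the call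
  have hpolU : ∀ p ∈ U, fderiv ℝ (v p.1) p.2 (EuclideanSpace.single 0 1) 1 =
      fderiv ℝ (v p.1) p.2 (EuclideanSpace.single 1 1) 0 := by
    intro p hp
    have h : curl (v p.1) p.2 2 = 0 := by
      simpa [EuclideanSpace.inner_single_right] using hpol p.1 (hUt p hp) p.2
    have h' : fderiv ℝ (v p.1) p.2 (EuclideanSpace.single 0 1) 1 - fderiv ℝ (v p.1) p.2 (EuclideanSpace.single 1 1) 0 = 0 := by
      simpa [curl] using h
    linarith
  have hdivU : ∀ p ∈ U, fderiv ℝ (v p.1) p.2 (EuclideanSpace.single 0 1) 0 +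
      fderiv ℝ (v p.1) p.2 (EuclideanSpace.single 1 1) 1 + fderiv ℝ (v p.1) p.2 (EuclideanSpace.single 2 1) 2 = 0 :=
    fun p hp => div_coord (hdiv p.1 (hUt p hp)) p.2
  exact ⟨μ', A, U, p₀, hUo, hp₀U, hUW, hanV.mono hUslab, hμ'an, hAan, hpolU, hdivU, hshear, hEq, htw p₀ hp₀W, hm0, hm1, hmz⟩

end Summit.NavierStokesRegularity.NavierStokesRegularity.Theorems.PoloidalWindowDoorLrcModEntireTwistingTHLocalDatum

end
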